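import Literature.Analysis.FluidPDE.NSCriticalClosureProofs
import Literature.Analysis.FluidPDE.KNSSTypeIIContinuation
import Literature.Analysis.FluidPDE.TaoEnstrophyLocalisationLeaves
import HarnessLib

/-!
# The `L³` continuation criterion — fourth assembly: ESS (3.6) and the continuation of bounded
# classical Leray–Hopf solutions

Analysis/FluidPDE proofs-layer file (theorems only, no named facts) for the named fact
`Literature.Analysis.FluidPDE.hasSmoothExtensionPast_of_eLpNorm_three_bounded`
(`NSCriticalClosure.lean`; Seregin 2012, Thm. 1.1 / Escauriaza–Seregin–Šverák 2003, Thms. 1.3–1.4,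
contrapositive): a classical solution of the unforced Navier–Stokes system on `ℝ³ × [0, T)` which
is Leray–Hopf from its rapidly decaying datum and has `sup_{0 ≤ t < T} ‖u(t)‖_{L³} < ∞` extends as a
classical solution past `T`.

The printed proof line (ESS 2003, §3, proof of Thm. 1.3, p. 226 of the translation: "by Theorem 1.4
and scaling … `max_{z ∈ ℝ³ × [δ, T]} |v(z)| < C₁(δ)` (3.6) … so `T` is not a blow-up time") has two
halves:

* **(3.5)–(3.6)**: an `L_{3,∞}` Leray–Hopf solution of the Cauchy problem is (essentially) bounded
  on `ℝ³ × (δ, T)` for every `δ > 0` — the named fact `ess_sup_bound` (`NSLerayHopfProofs.lean`);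
* **a bounded regular solution does not stop at `T`** — for classical Leray–Hopf solutions this is
  the named fact `hasSmoothExtensionPast_of_bounded` (`KNSSTypeII.lean`; Robinson–Rodrigo–Sadowski
  2016, Thm. 8.17 with Thms. 6.15, 6.10, 7.5; Leray 1934, §20), which the tree proves from Leray's
  local regular `H¹` theory (`hasSmoothExtensionPast_of_bounded_of_local_H1_theory`,
  `KNSSTypeIIContinuation.lean`; `tao2011_H1_local_almost_regular_of_leray`,
  `TaoEnstrophyLocalisationLeaves.lean`).

The earlier assemblies (`NSCriticalClosureProofs.lean`, `NSCriticalClosureTao.lean`) pair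
`ess_sup_bound` with Leray's blow-up rate (`leray_blowup_rate_top`), with Tao's local theory for
`H^∞` data (`tao2011_smooth_local_existence`), or replace it by Seregin's criterion
(`seregin_L3_blowup`). This file records the most literal rendering of the printed line:

* `hasSmoothExtensionPast_of_eLpNorm_three_bounded_of_ess_bounded :
    ess_sup_bound → hasSmoothExtensionPast_of_bounded → hasSmoothExtensionPast_of_eLpNorm_three_bounded`;
* `hasSmoothExtensionPast_of_eLpNorm_three_bounded_of_ess_local_H1 :
    ess_sup_bound → leray_local_strong_H1 → tao2011_H1_local_almost_regular → …`;
* `hasSmoothExtensionPast_of_eLpNorm_three_bounded_of_ess_leray_regular :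
    ess_sup_bound → leray_local_regular_H1 → …`,

so that the fact is discharged as soon as `ess_sup_bound` and `leray_local_regular_H1` (Leray 1934,
§§19–24 = Ożański–Pooley 2018, Thm. 6.30, Cor. 6.16) are.

## The proof

Let `u ∈ L^∞(0, T; L³)` (the slices are continuous with norms below the finite supremum,
`memLqLp_top_three_of_iSup_lt_top`), with datum `u 0 ∈ J̊` (Leray–Hopf). ESS (3.6) bounds `u`
essentially on `ℝ³ × (δ, T)` for every `δ ∈ (0, T)`, hence pointwise there, `u` being continuous
(`exists_forall_norm_le_of_memLqLp_top_top`: an open null set is empty). The bound is only away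
from `t = 0`, so restart: there is an energy-good time `s ∈ (0, T)` from which the translate
`u(· + s)` is a Leray–Hopf solution on `[0, T - s)` from `u(s)`
(`IsLerayHopfOn.exists_isLerayHopfOn_translate`); it is a classical solution on `[0, T - s)`
(`IsClassicalNSSolutionOn.translate_Ico_zero`) bounded on `[0, T - s) × ℝ³` (the bound on
`(s/2, T) × ℝ³`). By `hasSmoothExtensionPast_of_bounded` the translate extends past `T - s`, and an
extension of the translate glues to an extension of `u` past `T`
(`HasSmoothExtensionPast.of_translate`, `ClassicalSolutionGlue.lean`). The rapid decay of the datum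
is not used.

## References

* L. Escauriaza, G. Seregin, V. Šverák, *`L_{3,∞}`-solutions of Navier–Stokes equations and
  backward uniqueness*, Russ. Math. Surveys 58:2 (2003), 211–250, Thm. 1.3 and §3 (3.5)–(3.6).
  [EscauriazaSereginSverak2003]
* G. Seregin, *A certain necessary condition of potential blow up for Navier–Stokes equations*,
  Comm. Math. Phys. 312 (2012), 833–845 = arXiv:1104.3615, Thm. 1.1 (p. 2). [Seregin2012]
* J. C. Robinson, J. L. Rodrigo, W. Sadowski, *The Three-Dimensional Navier–Stokes Equations.
  Classical theory*, CUP 2016, Thm. 8.17 (PDF p. 131) with Thms. 6.15, 6.10 and the proof of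
  Thm. 12.3 (p. 170). [RobinsonRodrigoSadowski2016]
* J. Leray, Acta Math. 63 (1934), Ch. III §§19–24. [Leray1934]
-/

noncomputable section

open MeasureTheory Set Function Filter Topology
open scoped ENNReal NNReal

namespace Literature.Analysis.FluidPDE

/-- **Assembly 4: the `L³` continuation criterion from ESS (3.6) and the continuation of bounded
classical Leray–Hopf solutions** (Escauriaza–Seregin–Šverák 2003, proof of Thm. 1.3, §3
(3.5)–(3.6): an `L_{3,∞}` Leray–Hopf solution is bounded on `ℝ³ × (δ, T)`, "so `T` is not a
blow-up time"; the second half in the form `hasSmoothExtensionPast_of_bounded`, RRS 2016 Thm. 8.17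
with Thms. 6.15, 6.10). Restart at an energy-good time `s ∈ (0, T)`, where the translate
`u(· + s)` is classical, Leray–Hopf from `u(s)` and bounded on `[0, T - s) × ℝ³`; its extension past
`T - s` glues to an extension of `u` past `T`. The rapid decay of the datum is not used.
[cite: EscauriazaSereginSverak2003, Thm. 1.3 with §3 (3.5)–(3.6)] -/
theorem hasSmoothExtensionPast_of_eLpNorm_three_bounded_of_ess_bounded (h36 : ess_sup_bound)
    (hB : hasSmoothExtensionPast_of_bounded) : hasSmoothExtensionPast_of_eLpNorm_three_bounded := by
  intro ν T hν hT u p hsol hLH _h₀ h₃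
  -- `u ∈ L^∞(0, T; L³)` with datum in `J̊`
  have hL3 : MemLqLp ∞ 3 u (Ioo 0 T) := memLqLp_top_three_of_iSup_lt_top
    (fun t ht => (hsol.contDiff_velocity ht).continuous.aestronglyMeasurable) h₃
  have hdat2 : MemLp (u 0) 2 volume := hLH.memLp 0 ⟨le_rfl, hT.le⟩
  have hdiv0 : IsWeaklyDivFree (u 0) := hLH.isWeaklyDivFree_datum hT
  -- ESS (3.6): essentially bounded on `(δ, T) × ℝ³` for every `δ > 0`
  have hbd : ∀ δ ∈ Ioo 0 T, MemLqLp ∞ ∞ u (Ioo δ T) := h36 hν hT hdat2 hdiv0 hLH hL3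
  -- an energy-good restarting time `s ∈ (0, T)`
  obtain ⟨s, hs, hLHs⟩ := hLH.exists_isLerayHopfOn_translate hsol hν.le hT le_rfl
  -- a pointwise bound on `(s/2, T) × ℝ³`
  have hs2 : s / 2 ∈ Ioo 0 T := ⟨by linarith [hs.1], by linarith [hs.2]⟩
  have hcont : ContinuousOn (uncurry u) (Ioo (s / 2) T ×ˢ univ) :=
    hsol.smooth_velocity.continuousOn.mono
      (prod_mono (fun t ht => ⟨hs2.1.le.trans ht.1.le, ht.2⟩) Subset.rfl)
  obtain ⟨M, hM⟩ := exists_forall_norm_le_of_memLqLp_top_top hcont (hbd (s / 2) hs2)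
  -- the translate: classical on `[0, T - s)`, Leray–Hopf from `u s`, bounded on `[0, T - s) × ℝ³`
  have hsol' : IsClassicalNSSolutionOn (Ico 0 (T - s)) ν 0 (fun t => u (t + s))
      (fun t => p (t + s)) := hsol.translate_Ico_zero hs.1.le
  have hLHs' : IsLerayHopfOn (T - s) ν 0 ((fun t => u (t + s)) 0) (fun t => u (t + s)) := by
    show IsLerayHopfOn (T - s) ν 0 (u (0 + s)) (fun t => u (t + s))
    rw [zero_add]
    exact hLHs
  have hMs : ∃ M : ℝ, ∀ t ∈ Ico 0 (T - s), ∀ x, ‖(fun t => u (t + s)) t x‖ ≤ M :=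
    ⟨M, fun t ht x => hM (t + s) ⟨by linarith [ht.1, hs.1], by linarith [ht.2]⟩ x⟩
  -- continuation of the bounded translate past `T - s`, glued back to `u`
  have hext : HasSmoothExtensionPast ν 0 (fun t => u (t + s)) (T - s) :=
    hB hν (sub_pos.2 hs.2) hsol' hLHs' hMs
  exact HasSmoothExtensionPast.of_translate hsol hs.1 hs.2 hext

/-- The same from the local `H¹` theory leaves of `hasSmoothExtensionPast_of_bounded`
(`hasSmoothExtensionPast_of_bounded_of_local_H1_theory`, `KNSSTypeIIContinuation.lean`): ESS (3.6),
Leray's local strong `H¹` solutions (RRS 2016, Thm. 6.15) and Tao's almost regularity of the local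
`H¹` solution (Tao 2013, Thm. 5.4 (i)–(ii), Prop. 5.6) give the `L³` continuation criterion.
[cite: EscauriazaSereginSverak2003, Thm. 1.3 with §3 (3.5)–(3.6)] -/
theorem hasSmoothExtensionPast_of_eLpNorm_three_bounded_of_ess_local_H1 (h36 : ess_sup_bound)
    (h₁ : leray_local_strong_H1) (h₂ : tao2011_H1_local_almost_regular) :
    hasSmoothExtensionPast_of_eLpNorm_three_bounded :=
  hasSmoothExtensionPast_of_eLpNorm_three_bounded_of_ess_bounded h36
    (hasSmoothExtensionPast_of_bounded_of_local_H1_theory h₁ h₂)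

/-- **Two printed leaves.** ESS 2003, §3 (3.5)–(3.6) (`ess_sup_bound`) and Leray's local regular
solutions from `H¹` data (`leray_local_regular_H1`: Leray 1934, §§19–24 = Ożański–Pooley 2018,
Thm. 6.30, Cor. 6.16, Lemma 6.29; RRS 2016, Thm. 6.15), which projects onto `leray_local_strong_H1`
(`leray_local_strong_H1_of_regular`) and yields `tao2011_H1_local_almost_regular`
(`tao2011_H1_local_almost_regular_of_leray`), give the `L³` continuation criterion.
[cite: EscauriazaSereginSverak2003, Thm. 1.3 with §3 (3.5)–(3.6)] [cite: Leray1934, Ch. III §§19–24] -/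
theorem hasSmoothExtensionPast_of_eLpNorm_three_bounded_of_ess_leray_regular (h36 : ess_sup_bound)
    (hH1 : leray_local_regular_H1) : hasSmoothExtensionPast_of_eLpNorm_three_bounded :=
  hasSmoothExtensionPast_of_eLpNorm_three_bounded_of_ess_local_H1 h36
    (leray_local_strong_H1_of_regular hH1) (tao2011_H1_local_almost_regular_of_leray hH1)

/-- The conjunction form of `hasSmoothExtensionPast_of_eLpNorm_three_bounded_of_ess_leray_regular`,
for the dependency tracker: the fact is discharged as soon as `ess_sup_bound` and
`leray_local_regular_H1` are. [cite: EscauriazaSereginSverak2003, Thm. 1.3 with §3 (3.5)–(3.6)] -/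
theorem hasSmoothExtensionPast_of_eLpNorm_three_bounded_of_and₄
    (h : ess_sup_bound ∧ leray_local_regular_H1) :
    hasSmoothExtensionPast_of_eLpNorm_three_bounded :=
  hasSmoothExtensionPast_of_eLpNorm_three_bounded_of_ess_leray_regular h.1 h.2

end Literature.Analysis.FluidPDE

end
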